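import Literature.Probability.LatticeModels.LayeredPlaneRotatorSusceptibility
import Literature.Probability.LatticeModels.PlaneRotatorBoxSymmetry
import HarnessLib

/-!
# Translation invariance and symmetry of the infinite-volume two-point function of the LAYERED plane rotator:
# `G^{3D}(x + a, y + a) = G^{3D}(x, y) = G^{3D}(y, x) = G^{3D}(0, x − y)`

Topic `Literature/Probability/LatticeModels`. The layered companion of `PlaneRotatorFreeTwoPointInvariance.lean`:
the infinite-volume (free-state) two-point function `G^{3D}_{β; J∥, J⊥}(x, y) = sup_n ⟨cos(θ_x − θ_y)⟩_{[−n,n]³}`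
of the classical layered XY model on `ℤ³` (`PlaneRotator.infTwoPointLayered`, `LayeredPlaneRotatorSusceptibility.lean`
— the comparison model of the cell's 2D → 3D interlayer device) is defined through the cubes centred at the
origin, so the tree's statements about it are written at base point `0` (`summable_layered_of_…`,
`infTwoPointLayered_decay_of_summable`'s hypothesis, `aboxShellSum_cube_le_sum_sphere_infTwoPointLayered`, …).
The layered coupling array `(β/2)·J_{x,y}` (`layeredXYCoupling`: `J∥` in-plane, `J⊥` along the stacking axis) is
translation invariant in all three directions (`layeredCoupling_add`) and symmetric, hence:

* `volTwoPointLayered_translate` — the finite-volume two-point function is carried along by a translation of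
  the volume (relabelling, J. Ginibre, Comm. Math. Phys. **16** (1970) 310 [Ginibre1970], Example 4, tree
  `twoPoint_comp_equiv`), every `β, J∥, J⊥`; `volTwoPointLayered_comm`.
* `infTwoPointLayered_translate` (`β, J∥, J⊥ ≥ 0`, Griffiths–Ginibre monotonicity in the volume):
  `G^{3D}(x + a, y + a) = G^{3D}(x, y)` for every `a ∈ ℤ³` (in-plane AND inter-layer shifts);
  `infTwoPointLayered_comm` (every `β, J∥, J⊥`); `infTwoPointLayered_eq_zero_sub` / `…_sub'`,
  `infTwoPointLayered_base_add`, `infTwoPointLayered_self`.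
* Transfer: `le_infTwoPointLayered_of_forall_zero` / `infTwoPointLayered_le_of_forall_zero`,
  `summable_infTwoPointLayered_base_iff`, `tsum_infTwoPointLayered_base` (the stack's free susceptibility
  `χ^{3D} = ∑_z G^{3D}(x, z)` does not depend on the base point), `sum_sphere_infTwoPointLayered_base`.

Cell `pub/hubbard-tc` (MO-S3, interlayer row (1) / K4–K5 comparison model; lane `p1`, ruling R86 rider (iv)):
number-neutral support lemmas. WHAT THIS IS NOT: no new estimate, no threshold; symmetry bookkeeping only.
-/

noncomputable section

open MeasureTheory Finset Filter Topology
open scoped BigOperators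

namespace Literature.Probability.LatticeModels

namespace PlaneRotator

open Literature.Barriers.CriticalPhenomena Literature.Barriers.CriticalPhenomena.LongRangeIsing

variable [MeasurableSpace Circle] [BorelSpace Circle]

/-! ## §1 Finite volumes -/

section Volume

omit [MeasurableSpace Circle] [BorelSpace Circle] in
/-- `z + a` lies in the translate `Λ + a` of `Λ ⊂ ℤ³` iff `z ∈ Λ`. [folklore] -/
private theorem add_mem_image_add_iff₃ (Λ : Finset (Site 3)) (a z : Site 3) :
    z + a ∈ Λ.image (· + a) ↔ z ∈ Λ := by
  constructor
  · intro h
    obtain ⟨w, hw, hwz⟩ := Finset.mem_image.1 h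
    rwa [← add_right_cancel hwz]
  · exact fun h => Finset.mem_image_of_mem _ h

/-- **Translation covariance of the finite-volume two-point function of the layered model** (every `β, J∥, J⊥`,
every `a ∈ ℤ³`): `⟨cos(θ_{x+a} − θ_{y+a})⟩_{Λ+a} = ⟨cos(θ_x − θ_y)⟩_Λ` — the coupling array of `Λ + a` is the
relabelled array of `Λ` (`layeredCoupling_add`, `twoPoint_comp_equiv`). [cite: Ginibre1970, Example 4 (plane rotators)] -/
theorem volTwoPointLayered_translate (β Jp Jz : ℝ) (Λ : Finset (Site 3)) (a x y : Site 3) :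
    volTwoPointLayered β Jp Jz (Λ.image (· + a)) (x + a) (y + a) = volTwoPointLayered β Jp Jz Λ x y := by
  have hmem := add_mem_image_add_iff₃ Λ a
  by_cases h : x ∈ Λ ∧ y ∈ Λ
  · let e : Λ ≃ Λ.image (· + a) := (Equiv.addRight a).subtypeEquiv fun z => (hmem z).symm
    have he : ∀ u : Λ, ((e u : Λ.image (· + a)) : Site 3) = (u : Site 3) + a := fun _ => rfl
    rw [volTwoPointLayered_of_mem β Jp Jz h.1 h.2,
      volTwoPointLayered_of_mem β Jp Jz ((hmem x).2 h.1) ((hmem y).2 h.2)]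
    have key := twoPoint_comp_equiv e (layeredXYCoupling β Jp Jz (Λ.image (· + a))) ⟨x, h.1⟩ ⟨y, h.2⟩
    have hJ : (fun q : Λ × Λ => layeredXYCoupling β Jp Jz (Λ.image (· + a)) (e q.1, e q.2)) =
        layeredXYCoupling β Jp Jz Λ := by
      funext q
      simp only [layeredXYCoupling, he, layeredCoupling_add]
    rw [hJ] at key
    exact key.symm
  · have h' : ¬ (x + a ∈ Λ.image (· + a) ∧ y + a ∈ Λ.image (· + a)) := by rwa [hmem, hmem]
    unfold volTwoPointLayered
    rw [dif_neg h, dif_neg h']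

/-- The finite-volume two-point function of the layered model is symmetric in the two sites.
[cite: Ginibre1970, Example 4 (plane rotators)] -/
theorem volTwoPointLayered_comm (β Jp Jz : ℝ) (Λ : Finset (Site 3)) (x y : Site 3) :
    volTwoPointLayered β Jp Jz Λ x y = volTwoPointLayered β Jp Jz Λ y x := by
  by_cases h : x ∈ Λ ∧ y ∈ Λ
  · rw [volTwoPointLayered_of_mem β Jp Jz h.1 h.2, volTwoPointLayered_of_mem β Jp Jz h.2 h.1]
    exact twoPoint_comm _ _ _
  · have h' : ¬ (y ∈ Λ ∧ x ∈ Λ) := fun hyx => h ⟨hyx.2, hyx.1⟩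
    unfold volTwoPointLayered
    rw [dif_neg h, dif_neg h']

end Volume

/-! ## §2 The infinite volume -/

section Infinite

omit [MeasurableSpace Circle] [BorelSpace Circle] in
/-- A cube is the translate by `a` of its translate by `−a`. [folklore] -/
private theorem box₃_eq_image_image (n : ℕ) (a : Site 3) :
    box 3 n = ((box 3 n).image (· + -a)).image (· + a) := by
  rw [Finset.image_image]
  have hid : ((· + a) ∘ (· + -a) : Site 3 → Site 3) = id := by
    funext z
    simp only [Function.comp_apply, neg_add_cancel_right, id_eq]
  rw [hid, Finset.image_id]

/-- **Translation invariance of `G^{3D}`** (`β, J∥, J⊥ ≥ 0`): `G^{3D}(x + a, y + a) = G^{3D}(x, y)` for every shift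
`a ∈ ℤ³` — a translated cube is a finite volume, dominated by `G^{3D}(x, y)` (`volTwoPointLayered_le_inf`); symmetry
`a ↔ −a`. [cite: Ginibre1970, Prop. 3 with Example 4 (plane rotators); Simon1980CMP, Thm 1.3 (infinite-volume two-point function)] -/
theorem infTwoPointLayered_translate {β Jp Jz : ℝ} (hβ : 0 ≤ β) (hp : 0 ≤ Jp) (hz : 0 ≤ Jz) (a x y : Site 3) :
    infTwoPointLayered β Jp Jz (x + a) (y + a) = infTwoPointLayered β Jp Jz x y := by
  have key : ∀ b u v : Site 3, infTwoPointLayered β Jp Jz (u + b) (v + b) ≤ infTwoPointLayered β Jp Jz u v := by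
    intro b u v
    refine infTwoPointLayered_le_of_forall_box fun n => ?_
    rw [box₃_eq_image_image n b, volTwoPointLayered_translate]
    exact volTwoPointLayered_le_inf hβ hp hz _ u v
  refine le_antisymm (key a x y) ?_
  have h := key (-a) (x + a) (y + a)
  rwa [add_neg_cancel_right, add_neg_cancel_right] at h

/-- **Symmetry**: `G^{3D}(x, y) = G^{3D}(y, x)` (every `β, J∥, J⊥`). [cite: Ginibre1970, Example 4 (plane rotators)] -/
theorem infTwoPointLayered_comm (β Jp Jz : ℝ) (x y : Site 3) :
    infTwoPointLayered β Jp Jz x y = infTwoPointLayered β Jp Jz y x := by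
  unfold infTwoPointLayered
  congr 1
  funext n
  exact volTwoPointLayered_comm β Jp Jz _ x y

/-- **Reduction to base point `0`**: `G^{3D}(x, y) = G^{3D}(0, y − x)` (`β, J∥, J⊥ ≥ 0`).
[cite: Ginibre1970, Prop. 3 with Example 4 (plane rotators); Simon1980CMP, Thm 1.3] -/
theorem infTwoPointLayered_eq_zero_sub {β Jp Jz : ℝ} (hβ : 0 ≤ β) (hp : 0 ≤ Jp) (hz : 0 ≤ Jz) (x y : Site 3) :
    infTwoPointLayered β Jp Jz x y = infTwoPointLayered β Jp Jz 0 (y - x) := by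
  have h := infTwoPointLayered_translate hβ hp hz (-x) x y
  rw [add_neg_cancel, ← sub_eq_add_neg] at h
  exact h.symm

/-- **Reduction to base point `0`**, displacement `x − y`: `G^{3D}(x, y) = G^{3D}(0, x − y)` (`β, J∥, J⊥ ≥ 0`) — the
form matching the tree's decay statements in `‖x − y‖_∞`. [cite: Ginibre1970, Prop. 3 with Example 4 (plane rotators); Simon1980CMP, Thm 1.3] -/
theorem infTwoPointLayered_eq_zero_sub' {β Jp Jz : ℝ} (hβ : 0 ≤ β) (hp : 0 ≤ Jp) (hz : 0 ≤ Jz) (x y : Site 3) :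
    infTwoPointLayered β Jp Jz x y = infTwoPointLayered β Jp Jz 0 (x - y) := by
  rw [infTwoPointLayered_comm, infTwoPointLayered_eq_zero_sub hβ hp hz]

/-- `G^{3D}(x, x + b) = G^{3D}(0, b)` (`β, J∥, J⊥ ≥ 0`). [cite: Ginibre1970, Prop. 3 with Example 4 (plane rotators)] -/
theorem infTwoPointLayered_base_add {β Jp Jz : ℝ} (hβ : 0 ≤ β) (hp : 0 ≤ Jp) (hz : 0 ≤ Jz) (x b : Site 3) :
    infTwoPointLayered β Jp Jz x (x + b) = infTwoPointLayered β Jp Jz 0 b := by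
  rw [infTwoPointLayered_eq_zero_sub hβ hp hz, add_sub_cancel_left]

/-- The diagonal is trivial: `G^{3D}(x, x) = G^{3D}(0, 0)` (`β, J∥, J⊥ ≥ 0`). [cite: Ginibre1970, Example 4 (plane rotators)] -/
theorem infTwoPointLayered_self {β Jp Jz : ℝ} (hβ : 0 ≤ β) (hp : 0 ≤ Jp) (hz : 0 ≤ Jz) (x : Site 3) :
    infTwoPointLayered β Jp Jz x x = infTwoPointLayered β Jp Jz 0 0 := by
  rw [infTwoPointLayered_eq_zero_sub hβ hp hz, sub_self]

end Infinite

/-! ## §3 Transfer of base-point-`0` statements to arbitrary pairs -/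

section Transfer

/-- **Lower bounds transfer** to arbitrary pairs (`β, J∥, J⊥ ≥ 0`). [cite: Simon1980CMP, Thm 1.3 (infinite-volume two-point function)] -/
theorem le_infTwoPointLayered_of_forall_zero {β Jp Jz : ℝ} (hβ : 0 ≤ β) (hp : 0 ≤ Jp) (hz : 0 ≤ Jz)
    {f : Site 3 → ℝ} (h : ∀ z : Site 3, f z ≤ infTwoPointLayered β Jp Jz 0 z) (x y : Site 3) :
    f (x - y) ≤ infTwoPointLayered β Jp Jz x y := by
  rw [infTwoPointLayered_eq_zero_sub' hβ hp hz]
  exact h _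

/-- **Upper bounds transfer** to arbitrary pairs (`β, J∥, J⊥ ≥ 0`). [cite: Simon1980CMP, Thm 1.3 (infinite-volume two-point function)] -/
theorem infTwoPointLayered_le_of_forall_zero {β Jp Jz : ℝ} (hβ : 0 ≤ β) (hp : 0 ≤ Jp) (hz : 0 ≤ Jz)
    {f : Site 3 → ℝ} (h : ∀ z : Site 3, infTwoPointLayered β Jp Jz 0 z ≤ f z) (x y : Site 3) :
    infTwoPointLayered β Jp Jz x y ≤ f (x - y) := by
  rw [infTwoPointLayered_eq_zero_sub' hβ hp hz]
  exact h _

omit [MeasurableSpace Circle] [BorelSpace Circle] in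
/-- `z ↦ g(x, z)` is `g(0, ·)` precomposed with the bijection `z ↦ z − x` of `ℤ³`. [folklore] -/
private theorem comp_subRight_eq₃ (g : Site 3 → Site 3 → ℝ) (hg : ∀ x y, g x y = g 0 (y - x)) (x : Site 3) :
    (fun y => g x y) = (fun y => g 0 y) ∘ Equiv.subRight x := by
  funext y
  simp only [Function.comp_apply, Equiv.subRight_apply]
  exact hg x y

/-- **The stack's free susceptibility does not depend on the base point** (`β, J∥, J⊥ ≥ 0`):
`∑_z G^{3D}(x, z)` converges iff `∑_z G^{3D}(0, z)` does. [cite: Simon1980CMP, Thm 1.3 (χ = Σ_x ⟨σ₀σ_x⟩)] -/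
theorem summable_infTwoPointLayered_base_iff {β Jp Jz : ℝ} (hβ : 0 ≤ β) (hp : 0 ≤ Jp) (hz : 0 ≤ Jz)
    (x : Site 3) :
    (Summable fun y : Site 3 => infTwoPointLayered β Jp Jz x y) ↔
      Summable fun y : Site 3 => infTwoPointLayered β Jp Jz 0 y := by
  rw [comp_subRight_eq₃ (infTwoPointLayered β Jp Jz) (infTwoPointLayered_eq_zero_sub hβ hp hz) x]
  exact Equiv.summable_iff _

/-- … and has the same value: `∑_z G^{3D}(x, z) = ∑_z G^{3D}(0, z) = χ^{3D}` (`β, J∥, J⊥ ≥ 0`).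
[cite: Simon1980CMP, Thm 1.3 (χ = Σ_x ⟨σ₀σ_x⟩)] -/
theorem tsum_infTwoPointLayered_base {β Jp Jz : ℝ} (hβ : 0 ≤ β) (hp : 0 ≤ Jp) (hz : 0 ≤ Jz) (x : Site 3) :
    ∑' y : Site 3, infTwoPointLayered β Jp Jz x y = ∑' y : Site 3, infTwoPointLayered β Jp Jz 0 y := by
  have h := comp_subRight_eq₃ (infTwoPointLayered β Jp Jz) (infTwoPointLayered_eq_zero_sub hβ hp hz) x
  rw [show (∑' y : Site 3, infTwoPointLayered β Jp Jz x y) =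
      ∑' y : Site 3, (fun y => infTwoPointLayered β Jp Jz x y) y from rfl, h]
  exact Equiv.tsum_eq (Equiv.subRight x) fun y => infTwoPointLayered β Jp Jz 0 y

/-- **Sphere sums around any centre** (`β, J∥, J⊥ ≥ 0`): `∑_{‖b‖_∞ = R} G^{3D}(x, x + b) = ∑_{‖b‖_∞ = R} G^{3D}(0, b)`
— the quantity bounding Lieb's cube number (`aboxShellSum_cube_le_sum_sphere_infTwoPointLayered`) read around any
site. [cite: Simon1980CMP, Thm 1.3; Lieb1980, p. 128 (the box B)] -/
theorem sum_sphere_infTwoPointLayered_base {β Jp Jz : ℝ} (hβ : 0 ≤ β) (hp : 0 ≤ Jp) (hz : 0 ≤ Jz)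
    (x : Site 3) (R : ℕ) :
    ∑ b ∈ sphere 3 R, infTwoPointLayered β Jp Jz x (x + b) = ∑ b ∈ sphere 3 R, infTwoPointLayered β Jp Jz 0 b :=
  Finset.sum_congr rfl fun b _ => infTwoPointLayered_base_add hβ hp hz x b

end Transfer

end PlaneRotator

end Literature.Probability.LatticeModels

end
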